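import Literature.Topology.FourManifolds.SphereFamilySurgery
import Literature.Topology.FourManifolds.SmallSetComplement
import Mathlib.Analysis.Normed.Module.Connected
import HarnessLib

/-!
# Surgery below codimension two preserves connectedness

Topic `Literature/Topology/FourManifolds` (fact seat of
`Literature.Topology.FourManifolds.isOrientedBordant_of_isEmpty_of_signature_eq_zero`, Kirby
1989, Cor. IX.2 with VIII Thm 1(A): the bordism `W₁ = M × I ∪ 2-handles` is built by surgering
the CONNECTED closed 4-manifold `M` along framed circles *one at a time*, and each surgered
manifold must again be connected for the next step).  J. Milnor, *Lectures on the h-cobordism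
theorem* (1965), Def. 3.9–3.11 and §8, proof of Thm. 8.1 ("since `S_R` and `S_L'` have
codimension `≥ 2` their complement is connected"); W. Hurewicz, H. Wallman, *Dimension Theory*
(1941), Thm. IV 4.

For a framed family `ν : ι × Sᵏ × ℝᵐ ↪ X` of disjoint spheres in a connected manifold `X`
(finite `ι`, `X` Hausdorff and boundaryless, `dim X ≥ k + 2`):

* `FramedSphereFamily.isPathConnected_compl_cores`, `FramedSphereFamily.connectedSpace_complement`
  — **the complement `X ∖ ⋃ᵢ φᵢ(Sᵏ × 0)` of the core spheres is (path) connected**: the cores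
  are a closed set covered by finitely many `C¹` images of `ℝᵏ` (the core spheres read in the
  stereographic charts of `Sᵏ`), of codimension `≥ 2`, so the general-position theorem
  `isPathConnected_compl_of_subset_iUnion_image` (`SmallSetComplement.lean`) applies;
* `FramedSphereFamily.IsSurgery.connectedSpace` — **every manifold `P` obtained from `X` by
  surgery along `ν` (type `(k + 1, l + 1)`, `l ≥ 1`) is connected**: `P` is the union of the
  image of the connected `X ∖ cores` and of the images of the connected solid pieces
  `{i} × OD^{k+1} × Sˡ`, each of which meets the former (at a point `φᵢ(v, u/2) ∼ (i, v/2, u)` of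
  the punctured tube).

Everything is proved; no named facts.

## References

* J. Milnor, *Lectures on the h-cobordism theorem* (1965), Def. 3.9–3.11 (PDF pp. 16–17), §8
  proof of Thm. 8.1 (PDF p. 100). [MilnorHCobordism1965]
* W. Hurewicz, H. Wallman, *Dimension Theory*, Princeton (1941), Ch. IV §5, Thm. IV 4.
  [HurewiczWallman1941]
* R. C. Kirby, *The Topology of 4-Manifolds*, LNM 1374 (1989), Ch. VIII Thm 1(A) (proof).
  [Kirby1989]
-/

open scoped Manifold ContDiff Topology
open Set Function Metric Module

noncomputable section

namespace Literature.Topology.FourManifolds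

universe u v

/-- Local notation: `𝔼 n` is the model Euclidean space `EuclideanSpace ℝ (Fin n)`. -/
local notation "𝔼 " n:arg => EuclideanSpace ℝ (Fin n)

/-- Local notation: `𝕊 n` is the unit sphere in `EuclideanSpace ℝ (Fin (n + 1))`. -/
local notation "𝕊 " n:arg => (Metric.sphere (0 : EuclideanSpace ℝ (Fin (n + 1))) 1)

namespace FramedSphereFamily

variable {EX HX : Type*} [NormedAddCommGroup EX] [NormedSpace ℝ EX] [FiniteDimensional ℝ EX]
  [TopologicalSpace HX] {IX : ModelWithCorners ℝ EX HX}
  {X : Type u} [TopologicalSpace X] [ChartedSpace HX X] [IsManifold IX ∞ X]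
  [BoundarylessManifold IX X] [T2Space X]
  {ι : Type v} [Finite ι] {k m : ℕ} (ν : FramedSphereFamily IX X ι k m)

/-! ### §1 The complement of the core spheres is connected -/

omit [FiniteDimensional ℝ EX] [IsManifold IX ∞ X] [BoundarylessManifold IX X] [T2Space X] in
/-- **The core spheres are covered by finitely many `C¹` images of `ℝᵏ`**: finitely many
stereographic charts cover `Sᵏ` (compactness), and each core sphere `φᵢ(·, 0)` read in such a
chart is a `C^∞` map `ℝᵏ ⊇ U → X` on the (open) chart target. [folklore] -/
theorem exists_cores_subset_iUnion_image :
    ∃ (κ : Type (max u v)) (_ : Finite κ) (g : κ → (𝔼 k) → X) (U : κ → Set (𝔼 k)),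
      (∀ c, IsOpen (U c)) ∧ (∀ c, ContMDiffOn 𝓘(ℝ, 𝔼 k) IX 1 (g c) (U c)) ∧
        ν.cores ⊆ ⋃ c, g c '' U c := by
  -- finitely many chart sources cover the compact sphere
  obtain ⟨t, ht⟩ := isCompact_univ.elim_finite_subcover
    (fun c : 𝕊 k => (chartAt (𝔼 k) c).source) (fun c => (chartAt (𝔼 k) c).open_source)
    (fun w _ => mem_iUnion.2 ⟨w, mem_chart_source (𝔼 k) w⟩)
  refine ⟨ULift.{max u v} (ι × ↥t), inferInstance,
    fun c y => ν.sphere c.down.1 ((extChartAt (𝓡 k) (c.down.2 : 𝕊 k)).symm y),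
    fun c => (extChartAt (𝓡 k) (c.down.2 : 𝕊 k)).target,
    fun c => isOpen_extChartAt_target _, fun c => ?_, fun x hx => ?_⟩
  · exact ((ν.contMDiff_sphere c.down.1).of_le (mod_cast le_top)).comp_contMDiffOn
      (contMDiffOn_extChartAt_symm (c.down.2 : 𝕊 k))
  · obtain ⟨i, w, rfl⟩ := ν.mem_cores_iff.1 hx
    obtain ⟨c, hc, hwc⟩ : ∃ c ∈ t, w ∈ (chartAt (𝔼 k) c).source := by
      simpa only [mem_iUnion, exists_prop] using ht (mem_univ w)
    refine mem_iUnion.2 ⟨ULift.up (i, ⟨c, hc⟩), extChartAt (𝓡 k) c w, ?_, ?_⟩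
    · exact (extChartAt (𝓡 k) c).map_source (by rwa [extChartAt_source])
    · show ν.sphere i ((extChartAt (𝓡 k) c).symm (extChartAt (𝓡 k) c w)) = ν.sphere i w
      rw [(extChartAt (𝓡 k) c).left_inv (by rwa [extChartAt_source])]

variable [ConnectedSpace X]

/-- **The complement of the core spheres of a framed family is path connected** when
`dim X ≥ k + 2` (Milnor 1965, proof of Thm. 8.1: a compact submanifold of codimension `≥ 2`
does not separate; Hurewicz–Wallman Thm. IV 4), by the general-position theorem
`isPathConnected_compl_of_subset_iUnion_image` applied to the closed set `⋃ᵢ φᵢ(Sᵏ × 0)`.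
[cite: MilnorHCobordism1965, §8 proof of Thm. 8.1 (PDF p. 100)] -/
theorem isPathConnected_compl_cores (hk : k + 2 ≤ finrank ℝ EX) : IsPathConnected ν.coresᶜ := by
  obtain ⟨κ, _, g, U, hU, hg, hsub⟩ := ν.exists_cores_subset_iUnion_image
  have hdim : finrank ℝ (𝔼 k) + 2 ≤ finrank ℝ EX := by rwa [finrank_euclideanSpace_fin]
  exact isPathConnected_compl_of_subset_iUnion_image hdim ν.isClosed_cores
    (fun x _ => BoundarylessManifold.isInteriorPoint (I := IX)) g U hU hg hsub

/-- **The complement of the core spheres is connected** (`dim X ≥ k + 2`).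
[cite: MilnorHCobordism1965, §8 proof of Thm. 8.1 (PDF p. 100)] -/
theorem isConnected_compl_cores (hk : k + 2 ≤ finrank ℝ EX) : IsConnected ν.coresᶜ :=
  (ν.isPathConnected_compl_cores hk).isConnected

/-- **The open submanifold `X ∖ ⋃ᵢ φᵢ(Sᵏ × 0)` is a connected space** (`dim X ≥ k + 2`).
[cite: MilnorHCobordism1965, §8 proof of Thm. 8.1 (PDF p. 100)] -/
theorem connectedSpace_complement (hk : k + 2 ≤ finrank ℝ EX) : ConnectedSpace ↥ν.complement :=
  isConnected_iff_connectedSpace.1 (ν.isConnected_compl_cores hk)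

/-- In particular the complement of the cores is nonempty (`dim X ≥ k + 2`). [folklore] -/
theorem nonempty_complement (hk : k + 2 ≤ finrank ℝ EX) : Nonempty ↥ν.complement :=
  (ν.connectedSpace_complement hk).toNonempty

end FramedSphereFamily

/-! ### §2 The surgered manifold is connected -/

namespace FramedSphereFamily.IsSurgery

variable {EX HX : Type*} [NormedAddCommGroup EX] [NormedSpace ℝ EX] [FiniteDimensional ℝ EX]
  [TopologicalSpace HX] {IX : ModelWithCorners ℝ EX HX}
  {X : Type u} [TopologicalSpace X] [ChartedSpace HX X] [IsManifold IX ∞ X]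
  [BoundarylessManifold IX X] [T2Space X] [ConnectedSpace X]
  {ι : Type v} [Finite ι] {k l : ℕ} {ν : FramedSphereFamily IX X ι k (l + 1)}
  {EP HP : Type*} [NormedAddCommGroup EP] [NormedSpace ℝ EP] [TopologicalSpace HP]
  {IP : ModelWithCorners ℝ EP HP} {P : Type*} [TopologicalSpace P] [ChartedSpace HP P]

/-- The sphere `Sˡ`, `l ≥ 1`, is a connected space. [folklore] -/
theorem connectedSpace_sphere (hl : 1 ≤ l) : ConnectedSpace (𝕊 l) := by
  refine isConnected_iff_connectedSpace.1 (isConnected_sphere ?_ (0 : 𝔼 (l + 1)) zero_le_one)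
  rw [← Module.finrank_eq_rank, finrank_euclideanSpace_fin]
  exact_mod_cast Nat.lt_of_lt_of_le one_lt_two (Nat.succ_le_succ hl)

/-- The slice `{i} × OD^{k+1} × Sˡ` of the new piece, parametrised by the open unit ball and
the sphere. [folklore] -/
def slice (i : DiscreteIndex ι) (q : ↥(ball (0 : 𝔼 (k + 1)) 1) × (𝕊 l)) :
    ↥(ballTimesSphere ι k l) :=
  ⟨(i, (q.1 : 𝔼 (k + 1)), q.2), by simpa only [mem_ballTimesSphere_iff] using mem_ball_zero_iff.1 q.1.2⟩

omit [Finite ι] in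
/-- The slice parametrisation is continuous. [folklore] -/
theorem continuous_slice (i : DiscreteIndex ι) : Continuous (slice (ι := ι) (k := k) (l := l) i) :=
  Continuous.subtype_mk (continuous_const.prodMk
    ((continuous_subtype_val.comp continuous_fst).prodMk continuous_snd)) _

omit [Finite ι] in
/-- Every point of the new piece lies in the slice of its index. [folklore] -/
theorem exists_slice_eq (b : ↥(ballTimesSphere ι k l)) :
    ∃ q, slice (b : DiscreteIndex ι × ((𝔼 (k + 1)) × (𝕊 l))).1 q = b :=
  ⟨(⟨b.1.2.1, mem_ball_zero_iff.2 b.2⟩, b.1.2.2), rfl⟩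

/-- **A manifold obtained by surgery of type `(k + 1, l + 1)` with `l ≥ 1` on a connected
manifold of dimension `≥ k + 2` is connected** (Milnor 1965, Def. 3.11: `χ(V, φ)` is the union
of the image of `V ∖ φ(Sᵏ × 0)` — connected, the cores having codimension `l + 1 ≥ 2` — and of
the connected solid pieces `OD^{k+1} × Sˡ`, each meeting it along the punctured tube).  For
Kirby's 2-handles on a 4-manifold: `k = 1`, `l = 2`. [cite: MilnorHCobordism1965, Def. 3.11 (PDF p. 17), §8 proof of Thm. 8.1 (PDF p. 100)] -/
theorem connectedSpace (h : ν.IsSurgery IP P) (hk : k + 2 ≤ finrank ℝ EX) (hl : 1 ≤ l) :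
    ConnectedSpace P := by
  obtain ⟨jA, jB, hA, -, hB, -, hU, hR⟩ := h
  haveI := ν.connectedSpace_complement hk
  haveI := connectedSpace_sphere (l := l) hl
  haveI : ConnectedSpace ↥(ball (0 : 𝔼 (k + 1)) 1) :=
    isConnected_iff_connectedSpace.1 ((convex_ball (0 : 𝔼 (k + 1)) 1).isConnected
      ⟨0, mem_ball_self one_pos⟩)
  have hAc : IsConnected (range jA) := isConnected_range hA.isEmbedding.continuous
  -- the slices of the new piece, read in `P`
  set B : DiscreteIndex ι → Set P := fun i => range (jB ∘ slice i) with hBdef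
  have hBc : ∀ i, IsConnected (B i) := fun i =>
    isConnected_range (hB.isEmbedding.continuous.comp (continuous_slice i))
  -- each slice meets the image of the complement, at `φᵢ(v, u/2) ∼ (i, v/2, u)`
  have hmeet : ∀ i, (range jA ∩ B i).Nonempty := fun i => by
    set v₀ : 𝕊 k := ⟨EuclideanSpace.single 0 1, by simp⟩ with hv₀
    set u₀ : 𝕊 l := ⟨EuclideanSpace.single 0 1, by simp⟩ with hu₀
    have hhalf : ((1 : ℝ) / 2) • (u₀ : 𝔼 (l + 1)) ≠ 0 := by
      refine smul_ne_zero (by norm_num) ?_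
      have := u₀.2
      rw [mem_sphere_zero_iff_norm] at this
      exact fun h0 => by simp [h0] at this
    set a : ↥ν.complement :=
      ⟨ν.toFun (DiscreteIndex.mk.symm i) (v₀, ((1 : ℝ) / 2) • (u₀ : 𝔼 (l + 1))),
        ν.apply_mem_complement _ v₀ hhalf⟩ with ha
    have hyb : ((1 : ℝ) / 2) • (v₀ : 𝔼 (k + 1)) ∈ ball (0 : 𝔼 (k + 1)) 1 := by
      rw [mem_ball_zero_iff, norm_smul, mem_sphere_zero_iff_norm.1 v₀.2]
      norm_num
    set q : ↥(ball (0 : 𝔼 (k + 1)) 1) × (𝕊 l) := (⟨_, hyb⟩, u₀) with hq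
    have hrel : sphereFamilySurgeryRel ν a (slice i q) :=
      ⟨v₀, 1 / 2, ⟨by norm_num, by norm_num⟩, rfl, by simp [ha, slice, hq]⟩
    exact ⟨jA a, mem_range_self a, q, ((hR a (slice i q)).2 hrel).symm⟩
  -- `P = ⋃ᵢ (range jA ∪ Bᵢ)` (or `= range jA` when `ι` is empty)
  rw [connectedSpace_iff_univ, ← hU]
  rcases isEmpty_or_nonempty (DiscreteIndex ι) with hι | hι
  · have hB0 : range jB = ∅ := by
      rw [range_eq_empty_iff]
      exact ⟨fun b => hι.elim (b : DiscreteIndex ι × ((𝔼 (k + 1)) × (𝕊 l))).1⟩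
    rwa [hB0, union_empty]
  have hunion : range jA ∪ range jB = ⋃ i, (range jA ∪ B i) := by
    apply Subset.antisymm
    · rintro p (⟨a, rfl⟩ | ⟨b, rfl⟩)
      · exact mem_iUnion.2 ⟨Classical.arbitrary _, Or.inl (mem_range_self a)⟩
      · obtain ⟨q, hqb⟩ := exists_slice_eq b
        exact mem_iUnion.2 ⟨_, Or.inr ⟨q, congrArg jB hqb⟩⟩
    · refine iUnion_subset fun i => union_subset subset_union_left ?_
      rintro p ⟨q, rfl⟩
      exact Or.inr (mem_range_self _)
  rw [hunion]
  obtain ⟨a₀⟩ := ν.nonempty_complement hk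
  refine ⟨⟨jA a₀, mem_iUnion.2 ⟨Classical.arbitrary _, Or.inl (mem_range_self a₀)⟩⟩,
    isPreconnected_iUnion ⟨jA a₀, mem_iInter.2 fun i => Or.inl (mem_range_self a₀)⟩ fun i => ?_⟩
  exact (hAc.union (hmeet i) (hBc i)).isPreconnected

end FramedSphereFamily.IsSurgery

end Literature.Topology.FourManifolds
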